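/-
Copyright: the b2b-balaban T⁴-continuum CRUX team, row NE7b leaf lineage `t4-ne7b-formalise-leaf-04` (gen 148). Project licence.
-/
import Literature.MathematicalPhysics.QuantumFieldTheory.Balaban1983to89.B1
import Mathlib.Analysis.Normed.Group.Basic

/-!
# RESISTANCES ADD: the SHARP floor of the averaging step `⨅ y, (S y + a‖x − P y‖²)` is `(a⁻¹ + q²γ⁻¹)⁻¹‖x‖²` for `S ≥ γ‖·‖²`,
# `‖P y‖ ≤ q‖y‖` — and along a tower of such steps with `q² = L⁻²` the floors dominate `(L^{−2k}γ₀⁻¹ + a_k⁻¹)⁻¹` with the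
# printed `a_k = a(1 − L⁻²)∕(1 − L^{−2k})` of [Bałaban 1982, (2.13)–(2.15)] BY NAME (`…Balaban1983to89.B1.aSeq`), hence the UNIFORM floor
# `(γ₀⁻¹ + (a(1 − L⁻²))⁻¹)⁻¹` at every level (row NE7b, node U5c; residual (R2′) family (2), letter (ℓ1) in FORM currency; [folklore])

Cell `pub-balaban`, sub-cell `t4`, spine estimate NE7b (`T4WeightBudget.RelWeightBound`; the cell's OWN estimate — NOT PRINTED in [Bałaban 1983–89], NOT
PROVED).  Crux-route work under `Spine/NE7b/` (FREEZE (0) crux-prover clause) by leaf-04; NOTHING of Bałaban's is asserted or valued: the one printed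
object touched, the sequence `a_k` of [Balaban1982Higgs1] (2.15), enters BY NAME through the tree's `Literature.….Balaban1983to89.B1.aSeq` and its
KERNEL lemmas `aSeq_one ∕ aSeq_succ ∕ aSeq_pos ∕ ainf_lt_aSeq`; no `def`; zero `sorry`.  Imports: that BUILT Literature module + Mathlib.

WHY.  The sibling `…ComplementaryEliminationFloor` (this lineage, same gen) types idea-1's T-80 (J4): from the two SEPARATE letters
`γ‖y‖² ≤ J(x,y)` and `a‖x − P y‖² ≤ J(x,y)` the base form `x ↦ ⨅ y, J(x,y)` has floor `min(a∕4, γ∕(4q²))`.  That letter is the right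
one-junction statement; iterated with the rescaled contraction `q = L⁻¹`, `L ≥ 2`, it even stays `k`-uniform (`γ_k ≥ min(a∕4, γ₀)`, since
`4q² ≤ 1` — idea-1 g82's located reading R-AFT1-ne7bidea1-1), but it loses a constant factor `< 4`, does not reproduce print's `a_k`, and with
an unrescaled `q = 1` its loss compounds (`4^{−k}`).  When the two letters are SUMMED inside one joint form —
T-80's own shape `J(x,y) = T x + a‖x − P y‖² + S y`, and the shape the marginal step actually meets (the previous exponent's modulus form
`S` PLUS the soft averaging constraint; modulus forms add) — the sharp floor is the «parallel resistor» value: §1–§2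
`(a⁻¹ + q²γ⁻¹)⁻¹ = aγ∕(γ + aq²)`, attained in the quadratic model (§6), by ONE use of the triangle inequality `‖x‖ ≤ ‖P y‖ + ‖x − P y‖` and
the identity `(γ + aq²)(γs² + at²) − aγ(qs + t)² = (γs − aqt)²` — in ANY normed group, for ANY map `P`, ANY `S ≥ γ‖·‖²`.  In reciprocal
(«resistance») currency the step reads `γ′⁻¹ = a⁻¹ + q²·γ⁻¹`, which DOES iterate: along a tower of steps with a common `a` and `q² = r`,
`γ_k⁻¹ ≤ r^k γ₀⁻¹ + a⁻¹(1 + r + ⋯ + r^{k−1})` (§3), and for `r = L⁻²` the second term IS `a_k⁻¹` for the printed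
`a_k = a(1 − L⁻²)∕(1 − L^{−2k})`, `a_{k+1} = a·a_k∕(aL⁻² + a_k)` ([Balaban1982Higgs1] (2.13)–(2.15) p. 609; the tree's `B1.aSeq`, `B1.aSeq_succ`):
§4 `γ_k⁻¹ ≤ L^{−2k}γ₀⁻¹ + (a_k)⁻¹`, so `γ_k ≥ (γ₀⁻¹ + (a(1 − L⁻²))⁻¹)⁻¹` UNIFORMLY IN `k` (`a_k > a_∞ = a(1 − L⁻²)`, `B1.ainf_lt_aSeq`).  §5
packages the induction over an ℕ-indexed tower of normed groups `E k`, forms `S k` and averaging maps `P k : E k → E (k+1)` under the one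
displayed step letter «`S (k+1) x` dominates every lower bound of `y ↦ S k y + a‖x − P k y‖²`» (what `…ConvexityModulusSchur` §3 +
`…LogConcaveMarginal` §6 hand to the next scale, read pointwise).  PRIOR ART IN THE TREE (not restated, different currency): the EXACT
Gaussian semigroup of the scalar quadratic forms `Δ_k(u)` with the same `a_k` is `Literature.….BalabanImbrieJaffe1984to88.BIJ85ScalarFormSemigroup`
(inner-product spaces, linear `Q` with `‖Qδ‖² ≤ N⁻¹‖δ‖²`, centred quadratic data, infimum ATTAINED); THIS FILE is the FLOOR (inequality) half
for GENERAL exponents `S ≥ γ‖·‖²` in normed groups with any map `P` — the currency of the NE7b convexity road — and its tower.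
BY VALUE (honest): which `a`, `P`, `q` a step of print displays in which chart, and that `q² = L⁻²` after the rescaling, are (A3) ∕ (A1c)
readings (NC-NE7b-α UNRULED); the floors here are GLOBAL on `E k` (`γ₀‖y‖² ≤ S 0 y` on the whole space) — for a massless fine action that is
the volume's spectral gap, so by value this file carries the `a_k` letter of the averaging penalty, NOT the road's FIBRE floor `λ` (whose shape
is `…CoerciveFluctuationFloor`'s, values printed nowhere; idea-1 T-82 (α)); the uniform floor here is the AVERAGING (Gaussian-shape) mechanism
only — the polymer ∕ boundary parts of the effective action are print's renormalized bracket (refuter R-AHL-g83-1 (c)), untouched.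

WHAT IS PROVED ([folklore]):
* §1 (any normed group) **`harmonic_mul_norm_sq_le`** — `0 < μ`, `0 < a` ⊢ `μa∕(μ+a)·‖x‖² ≤ μ‖u‖² + a‖x − u‖²` (triangle inequality +
  `(μ+a)(μs²+at²) − μa(s+t)² = (μs−at)²`; no inner product).
* §2 (normed groups `E₁ ∋ x`, `E₂ ∋ y`, any `S : E₂ → ℝ`, any `P : E₂ → E₁`) **`floor_of_sum`** — `0 < a`, `0 < γ`, `∀ y, γ‖y‖² ≤ S y`,
  `∀ y, ‖P y‖ ≤ q‖y‖` ⊢ `∀ x y, aγ∕(γ + aq²)·‖x‖² ≤ S y + a‖x − P y‖²`; `floor_of_sum_le` (any `J ≥ S y + a‖x − P y‖²`, e.g. `+ T x` with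
  `T ≥ 0`); **`le_iInf_of_sum`** (`≤ ⨅ y, (S y + a‖x − P y‖²)` — `…ConvexityModulusSchur` §3's sharp base form); `inv_floor_of_sum`
  (`(aγ∕(γ + aq²))⁻¹ = a⁻¹ + q²γ⁻¹`: resistances add); `floor_of_sum_pos`.
* §3 (real sequences) **`recip_le_of_rec`** — `0 ≤ r`, `ρ (k+1) ≤ a⁻¹ + r·ρ k` for all `k` ⊢ `ρ k ≤ r^k ρ 0 + a⁻¹ Σ_{j<k} r^j`;
  `recip_le_uniform_of_rec` (`r < 1`, `0 ≤ ρ 0`, `0 < a` ⊢ `ρ k ≤ ρ 0 + a⁻¹∕(1 − r)`).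
* §4 junction with print's letter BY NAME: `inv_aSeq_succ` (`(a_{k+1})⁻¹ = a⁻¹ + L⁻²·(a_k)⁻¹`, from `B1.aSeq_succ`), `inv_aSeq_eq_geom`
  (`(a_k)⁻¹ = a⁻¹ Σ_{j<k} L^{−2j}`), **`recip_le_pow_add_inv_aSeq`** (`ρ (k+1) ≤ a⁻¹ + L⁻²·ρ k` ⊢ `ρ k ≤ L^{−2k}ρ 0 + (a_k)⁻¹`, `k ≥ 1`),
  **`floor_ge_of_rec_aSeq`** (floors `γ k > 0` with `(γ (k+1))⁻¹ ≤ a⁻¹ + L⁻²(γ k)⁻¹` ⊢ `(L^{−2k}γ₀⁻¹ + (a_k)⁻¹)⁻¹ ≤ γ k`),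
  **`floor_ge_uniform_aSeq`** (⊢ `(γ₀⁻¹ + (a(1 − L⁻²))⁻¹)⁻¹ ≤ γ k`, every `k`).
* §5 THE TOWER: **`tower_floor`** — types `E : ℕ → Type*` (normed groups), forms `S k : E k → ℝ`, maps `P k : E k → E (k+1)` with
  `‖P k y‖ ≤ q‖y‖`, weight `a > 0`, the step letter `∀ k x c, (∀ y, c ≤ S k y + a‖x − P k y‖²) → c ≤ S (k+1) x`, and `γ₀‖y‖² ≤ S 0 y`
  (`γ₀ > 0`) ⊢ with `γ (k+1) = aγ_k∕(γ_k + aq²)`: `∀ k y, γ k·‖y‖² ≤ S k y` (and `0 < γ k`); `tower_inv_rec`; **`tower_floor_aSeq`** (`q = L⁻¹`, `1 < L` ⊢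
  `∀ k ≥ 1, ∀ y, (L^{−2k}γ₀⁻¹ + (B1.aSeq a L k)⁻¹)⁻¹·‖y‖² ≤ S k y`); **`tower_floor_uniform`** (⊢ `∀ k y, (γ₀⁻¹ + (a(1 − L⁻²))⁻¹)⁻¹·‖y‖² ≤ S k y`).
* §6 kernel toys on `ℝ`: the one-step value is attained (`S y = γy²`, `P y = q y`: equality at `y⋆ = aq x∕(γ + aq²)`); §2 inhabited.

NOT HERE (honest): centred data `S ≥ γ‖· − y₀‖²` (compose with a translation; the exact centred Gaussian composition is BIJ85's file); which
steps of print have the averaging shape and the rescaled contraction `q = L⁻¹` ((A3) ∕ (A1c)); the polymer part's uniformity (print's Π ∕ β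
bracket, not a floor letter); anything of Bałaban's asserted.  BY-NAME EFFECT ON THE WALL: NONE.  NE7b NOT PRINTED ∕ NOT PROVED; spine PROVED
0∕9; rung (B)+1 on a FINITE torus — NOT infinite volume, NOT the mass gap, NOT Clay.  HONEST DEPENDENCY: continuum YM on T⁴ ⇐ BetaPertH ∧ nine
spine estimates (0/9 proved); BetaPertH ⇐ (D1) ∧ (D4) ∧ CAP+tail; G-an2-4 gates asym, D1 and NE2∕3∕4.
-/

set_option autoImplicit false

noncomputable section

open Finset

namespace Summit.QuantumFields.BalabanUV.T4Continuum.NE7b.AveragingFloorTower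

/-! ## §1 The harmonic (parallel-resistor) inequality in a normed group -/

section Harmonic

variable {E : Type*} [NormedAddCommGroup E]

/-- **`μa∕(μ+a)·‖x‖² ≤ μ‖u‖² + a‖x − u‖²`** in ANY normed group (`0 < μ`, `0 < a`): from `‖x‖ ≤ ‖u‖ + ‖x − u‖` and
`(μ+a)(μs² + at²) − μa(s+t)² = (μs − at)² ≥ 0`.  No inner product is used. [folklore] -/
theorem harmonic_mul_norm_sq_le {μ a : ℝ} (hμ : 0 < μ) (ha : 0 < a) (x u : E) :
    μ * a / (μ + a) * ‖x‖ ^ 2 ≤ μ * ‖u‖ ^ 2 + a * ‖x - u‖ ^ 2 := by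
  have htri : ‖x‖ ≤ ‖u‖ + ‖x - u‖ := norm_le_norm_add_norm_sub' x u
  have h1 : ‖x‖ ^ 2 ≤ (‖u‖ + ‖x - u‖) ^ 2 := pow_le_pow_left₀ (norm_nonneg _) htri 2
  rw [div_mul_eq_mul_div, div_le_iff₀ (add_pos hμ ha)]
  nlinarith [sq_nonneg (μ * ‖u‖ - a * ‖x - u‖), mul_pos hμ ha, norm_nonneg u, norm_nonneg (x - u)]

end Harmonic

/-! ## §2 The sharp one-step floor of the summed form -/

section OneStep

variable {E₁ E₂ : Type*} [NormedAddCommGroup E₁] [NormedAddCommGroup E₂]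

/-- **THE SHARP FLOOR OF THE AVERAGING STEP** (pointwise): `S ≥ γ‖·‖²` (`0 < γ`), `‖P y‖ ≤ q‖y‖`, `0 < a` ⊢
`aγ∕(γ + aq²)·‖x‖² ≤ S y + a‖x − P y‖²` for all `x, y` — `‖x‖ ≤ q‖y‖ + ‖x − P y‖` and `(γ + aq²)(γs² + at²) − aγ(qs + t)² = (γs − aqt)²`.
ANY normed groups, ANY map `P`, ANY `S`. [folklore] -/
theorem floor_of_sum {S : E₂ → ℝ} {P : E₂ → E₁} {a γ q : ℝ} (ha : 0 < a) (hγ : 0 < γ) (hS : ∀ y, γ * ‖y‖ ^ 2 ≤ S y)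
    (hP : ∀ y, ‖P y‖ ≤ q * ‖y‖) (x : E₁) (y : E₂) : a * γ / (γ + a * q ^ 2) * ‖x‖ ^ 2 ≤ S y + a * ‖x - P y‖ ^ 2 := by
  have htri : ‖x‖ ≤ q * ‖y‖ + ‖x - P y‖ := (norm_le_norm_add_norm_sub' x (P y)).trans (by linarith [hP y])
  have h1 : ‖x‖ ^ 2 ≤ (q * ‖y‖ + ‖x - P y‖) ^ 2 := pow_le_pow_left₀ (norm_nonneg _) htri 2
  have hden : 0 < γ + a * q ^ 2 := by positivity
  rw [div_mul_eq_mul_div, div_le_iff₀ hden]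
  nlinarith [sq_nonneg (γ * ‖y‖ - a * q * ‖x - P y‖), hS y, mul_pos ha hγ, norm_nonneg y, norm_nonneg (x - P y), sq_nonneg q,
    mul_nonneg ha.le (sq_nonneg q)]

/-- The same for any joint function dominating the summed form (`S y + a‖x − P y‖² ≤ J(x,y)`, e.g. `J = T x + a‖x − P y‖² + S y` with
`T ≥ 0`). [folklore] -/
theorem floor_of_sum_le {J : E₁ × E₂ → ℝ} {S : E₂ → ℝ} {P : E₂ → E₁} {a γ q : ℝ} (ha : 0 < a) (hγ : 0 < γ)
    (hS : ∀ y, γ * ‖y‖ ^ 2 ≤ S y) (hP : ∀ y, ‖P y‖ ≤ q * ‖y‖) (hJ : ∀ x y, S y + a * ‖x - P y‖ ^ 2 ≤ J (x, y)) (x : E₁) (y : E₂) :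
    a * γ / (γ + a * q ^ 2) * ‖x‖ ^ 2 ≤ J (x, y) :=
  (floor_of_sum ha hγ hS hP x y).trans (hJ x y)

/-- **THE SHARP FLOOR, `⨅`-currency** (`…ConvexityModulusSchur` §3's sharp base form of the summed joint form). [folklore] -/
theorem le_iInf_of_sum [Nonempty E₂] {S : E₂ → ℝ} {P : E₂ → E₁} {a γ q : ℝ} (ha : 0 < a) (hγ : 0 < γ)
    (hS : ∀ y, γ * ‖y‖ ^ 2 ≤ S y) (hP : ∀ y, ‖P y‖ ≤ q * ‖y‖) (x : E₁) :
    a * γ / (γ + a * q ^ 2) * ‖x‖ ^ 2 ≤ ⨅ y, (S y + a * ‖x - P y‖ ^ 2) :=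
  le_ciInf fun y => floor_of_sum ha hγ hS hP x y

/-- **RESISTANCES ADD**: the reciprocal of the one-step floor is `a⁻¹ + q²γ⁻¹`. [folklore] -/
theorem inv_floor_of_sum {a γ q : ℝ} (ha : 0 < a) (hγ : 0 < γ) : (a * γ / (γ + a * q ^ 2))⁻¹ = a⁻¹ + q ^ 2 * γ⁻¹ := by
  have hden : γ + a * q ^ 2 ≠ 0 := by positivity
  rw [inv_div, div_eq_iff (by positivity : a * γ ≠ 0)]
  field_simp

/-- The one-step floor is positive. [folklore] -/
theorem floor_of_sum_pos {a γ q : ℝ} (ha : 0 < a) (hγ : 0 < γ) : 0 < a * γ / (γ + a * q ^ 2) := by positivity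

end OneStep

/-! ## §3 The reciprocal recursion `ρ_{k+1} ≤ a⁻¹ + r·ρ_k` -/

section Recursion

/-- **`ρ_{k+1} ≤ a⁻¹ + rρ_k` ⟹ `ρ_k ≤ r^k ρ₀ + a⁻¹ Σ_{j<k} r^j`** (`0 ≤ r`). [folklore] -/
theorem recip_le_of_rec {ρ : ℕ → ℝ} {a r : ℝ} (hr : 0 ≤ r) (hrec : ∀ k, ρ (k + 1) ≤ a⁻¹ + r * ρ k) (k : ℕ) :
    ρ k ≤ r ^ k * ρ 0 + a⁻¹ * ∑ j ∈ range k, r ^ j := by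
  induction k with
  | zero => simp
  | succ k ih =>
    calc ρ (k + 1) ≤ a⁻¹ + r * ρ k := hrec k
      _ ≤ a⁻¹ + r * (r ^ k * ρ 0 + a⁻¹ * ∑ j ∈ range k, r ^ j) := by gcongr
      _ = r ^ (k + 1) * ρ 0 + a⁻¹ * ∑ j ∈ range (k + 1), r ^ j := by
          have hs : ∑ j ∈ range (k + 1), r ^ j = 1 + r * ∑ j ∈ range k, r ^ j := by
            rw [sum_range_succ', pow_zero, mul_sum, add_comm]
            exact congrArg (1 + ·) (sum_congr rfl fun j _ => pow_succ' r j)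
          rw [hs]; ring

/-- … hence, for `0 ≤ r < 1`, `0 < a`, `0 ≤ ρ₀`: the UNIFORM bound `ρ_k ≤ ρ₀ + a⁻¹∕(1 − r)`. [folklore] -/
theorem recip_le_uniform_of_rec {ρ : ℕ → ℝ} {a r : ℝ} (ha : 0 < a) (hr : 0 ≤ r) (hr1 : r < 1) (hρ0 : 0 ≤ ρ 0)
    (hrec : ∀ k, ρ (k + 1) ≤ a⁻¹ + r * ρ k) (k : ℕ) : ρ k ≤ ρ 0 + a⁻¹ / (1 - r) := by
  have h := recip_le_of_rec hr hrec k
  have hgeom : ∑ j ∈ range k, r ^ j ≤ (1 - r)⁻¹ := by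
    rw [inv_eq_one_div, le_div_iff₀ (by linarith), geom_sum_mul_neg]
    linarith [pow_nonneg hr k]
  have hrk : r ^ k ≤ 1 := pow_le_one₀ hr hr1.le
  calc ρ k ≤ r ^ k * ρ 0 + a⁻¹ * ∑ j ∈ range k, r ^ j := h
    _ ≤ 1 * ρ 0 + a⁻¹ * (1 - r)⁻¹ := by gcongr
    _ = ρ 0 + a⁻¹ / (1 - r) := by rw [one_mul, div_eq_mul_inv]

end Recursion

/-! ## §4 Junction with the printed letter `a_k` BY NAME (`…Balaban1983to89.B1.aSeq`, [Balaban1982Higgs1] (2.13)–(2.15) p. 609) -/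

section PrintedLetter

open Literature.MathematicalPhysics.QuantumFieldTheory.Balaban1983to89.B1 (aSeq aSeq_one aSeq_succ aSeq_pos ainf_lt_aSeq)

/-- The printed recursion (2.13) `a_{k+1} = a·a_k∕(aL⁻² + a_k)` (the tree's KERNEL `B1.aSeq_succ`) in reciprocal currency:
`(a_{k+1})⁻¹ = a⁻¹ + L⁻²·(a_k)⁻¹` — resistances add. [folklore] -/
theorem inv_aSeq_succ {a L : ℝ} (ha : 0 < a) (hL : 1 < L) {k : ℕ} (hk : 1 ≤ k) :
    (aSeq a L (k + 1))⁻¹ = a⁻¹ + (L ^ 2)⁻¹ * (aSeq a L k)⁻¹ := by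
  have hpos := aSeq_pos ha hL hk
  have hL2 : 0 < L ^ 2 := by positivity
  rw [aSeq_succ ha hL hk]
  field_simp
  ring

/-- The printed closed form in reciprocal currency: `(a_k)⁻¹ = a⁻¹·Σ_{j<k} L^{−2j}` (`k ≥ 1`) — the partial geometric series of
resistances (`B1.aSeq_one` + `inv_aSeq_succ`, induction). [folklore] -/
theorem inv_aSeq_eq_geom {a L : ℝ} (ha : 0 < a) (hL : 1 < L) {k : ℕ} (hk : 1 ≤ k) :
    (aSeq a L k)⁻¹ = a⁻¹ * ∑ j ∈ range k, ((L ^ 2)⁻¹) ^ j := by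
  induction k, hk using Nat.le_induction with
  | base => rw [aSeq_one hL]; simp
  | succ n hn ih =>
    have hs : ∑ j ∈ range (n + 1), ((L ^ 2)⁻¹) ^ j = 1 + (L ^ 2)⁻¹ * ∑ j ∈ range n, ((L ^ 2)⁻¹) ^ j := by
      rw [sum_range_succ', pow_zero, mul_sum, add_comm]
      exact congrArg (1 + ·) (sum_congr rfl fun j _ => pow_succ' _ j)
    rw [inv_aSeq_succ ha hL hn, ih, hs]
    ring

/-- **THE RECIPROCAL RECURSION IS DOMINATED BY PRINT's `a_k`**: `ρ_{k+1} ≤ a⁻¹ + L⁻²ρ_k` for all `k` ⟹ `ρ_k ≤ L^{−2k}ρ₀ + (a_k)⁻¹` for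
`k ≥ 1` (equality throughout for `ρ_{k+1} = a⁻¹ + L⁻²ρ_k`: then `ρ_k − L^{−2k}ρ₀` IS `(a_k)⁻¹`, by `B1.aSeq_one` ∕ `B1.aSeq_succ`). [folklore] -/
theorem recip_le_pow_add_inv_aSeq {ρ : ℕ → ℝ} {a L : ℝ} (ha : 0 < a) (hL : 1 < L) (hrec : ∀ k, ρ (k + 1) ≤ a⁻¹ + (L ^ 2)⁻¹ * ρ k)
    {k : ℕ} (hk : 1 ≤ k) : ρ k ≤ ((L ^ 2)⁻¹) ^ k * ρ 0 + (aSeq a L k)⁻¹ := by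
  induction k, hk using Nat.le_induction with
  | base =>
    rw [aSeq_one hL, pow_one]
    linarith [hrec 0]
  | succ n hn ih =>
    have hr : 0 ≤ (L ^ 2)⁻¹ := by positivity
    calc ρ (n + 1) ≤ a⁻¹ + (L ^ 2)⁻¹ * ρ n := hrec n
      _ ≤ a⁻¹ + (L ^ 2)⁻¹ * (((L ^ 2)⁻¹) ^ n * ρ 0 + (aSeq a L n)⁻¹) := by gcongr
      _ = ((L ^ 2)⁻¹) ^ (n + 1) * ρ 0 + (aSeq a L (n + 1))⁻¹ := by rw [inv_aSeq_succ ha hL hn]; ring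

/-- **FLOORS ALONG THE RECURSION DOMINATE `(L^{−2k}γ₀⁻¹ + a_k⁻¹)⁻¹`**: positive `γ_k` with `(γ_{k+1})⁻¹ ≤ a⁻¹ + L⁻²(γ_k)⁻¹` satisfy
`(L^{−2k}γ₀⁻¹ + (a_k)⁻¹)⁻¹ ≤ γ_k` for `k ≥ 1`. [folklore] -/
theorem floor_ge_of_rec_aSeq {γ : ℕ → ℝ} {a L : ℝ} (ha : 0 < a) (hL : 1 < L) (hpos : ∀ k, 0 < γ k)
    (hrec : ∀ k, (γ (k + 1))⁻¹ ≤ a⁻¹ + (L ^ 2)⁻¹ * (γ k)⁻¹) {k : ℕ} (hk : 1 ≤ k) :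
    (((L ^ 2)⁻¹) ^ k * (γ 0)⁻¹ + (aSeq a L k)⁻¹)⁻¹ ≤ γ k := by
  have h := recip_le_pow_add_inv_aSeq (ρ := fun k => (γ k)⁻¹) ha hL hrec hk
  have h0 := hpos 0
  have hak := aSeq_pos ha hL hk
  have hR : 0 < ((L ^ 2)⁻¹) ^ k * (γ 0)⁻¹ + (aSeq a L k)⁻¹ := by positivity
  rw [inv_le_comm₀ hR (hpos k)]
  exact h

/-- **THE UNIFORM FLOOR**: under the same letters, `(γ₀⁻¹ + (a(1 − L⁻²))⁻¹)⁻¹ ≤ γ_k` for EVERY `k` (`a_k > a_∞ = a(1 − L⁻²)`,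
`B1.ainf_lt_aSeq`; `L^{−2k} ≤ 1`). [folklore] -/
theorem floor_ge_uniform_aSeq {γ : ℕ → ℝ} {a L : ℝ} (ha : 0 < a) (hL : 1 < L) (hpos : ∀ k, 0 < γ k)
    (hrec : ∀ k, (γ (k + 1))⁻¹ ≤ a⁻¹ + (L ^ 2)⁻¹ * (γ k)⁻¹) (k : ℕ) :
    ((γ 0)⁻¹ + (a * (1 - (L ^ 2)⁻¹))⁻¹)⁻¹ ≤ γ k := by
  have hr1 : (L ^ 2)⁻¹ < 1 := inv_lt_one_of_one_lt₀ (by nlinarith)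
  have hr0 : 0 ≤ (L ^ 2)⁻¹ := by positivity
  have hainf : 0 < a * (1 - (L ^ 2)⁻¹) := mul_pos ha (by linarith)
  have h0 := hpos 0
  rcases Nat.eq_zero_or_pos k with rfl | hk
  · calc ((γ 0)⁻¹ + (a * (1 - (L ^ 2)⁻¹))⁻¹)⁻¹ ≤ ((γ 0)⁻¹)⁻¹ :=
          inv_anti₀ (by positivity) (le_add_of_nonneg_right (by positivity))
      _ = γ 0 := inv_inv _
  · refine le_trans ?_ (floor_ge_of_rec_aSeq ha hL hpos hrec hk)
    have hak := aSeq_pos ha hL hk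
    refine inv_anti₀ (by positivity) (add_le_add ?_ ?_)
    · calc ((L ^ 2)⁻¹) ^ k * (γ 0)⁻¹ ≤ 1 * (γ 0)⁻¹ :=
            mul_le_mul_of_nonneg_right (pow_le_one₀ hr0 hr1.le) (by positivity)
        _ = (γ 0)⁻¹ := one_mul _
    · exact inv_anti₀ hainf (ainf_lt_aSeq ha hL k hk).le

end PrintedLetter

/-! ## §5 The tower of averaging steps -/

section Tower

open Literature.MathematicalPhysics.QuantumFieldTheory.Balaban1983to89.B1 (aSeq aSeq_pos)

variable (E : ℕ → Type*) [∀ k, NormedAddCommGroup (E k)]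

/-- **THE TOWER OF FLOORS**: normed groups `E k`, forms `S k : E k → ℝ`, averaging maps `P k : E k → E (k+1)` with `‖P k y‖ ≤ q‖y‖`, a weight
`a > 0`, the STEP LETTER «`S (k+1) x` dominates every lower bound of `y ↦ S k y + a‖x − P k y‖²`» (what the marginal step hands up, read
pointwise — implied by `⨅ y, (S k y + a‖x − P k y‖²) ≤ S (k+1) x`), and an initial floor `γ₀‖y‖² ≤ S 0 y` (`γ₀ > 0`) ⊢ the recursively
defined floors `γ (k+1) = aγ_k∕(γ_k + aq²)` are positive and `γ k·‖y‖² ≤ S k y` at EVERY level. [folklore] -/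
theorem tower_floor (S : ∀ k, E k → ℝ) (P : ∀ k, E k → E (k + 1)) {a q γ₀ : ℝ} (ha : 0 < a) (hγ₀ : 0 < γ₀)
    (hP : ∀ (k) (y : E k), ‖P k y‖ ≤ q * ‖y‖)
    (hstep : ∀ (k) (x : E (k + 1)) (c : ℝ), (∀ y : E k, c ≤ S k y + a * ‖x - P k y‖ ^ 2) → c ≤ S (k + 1) x)
    (h0 : ∀ y : E 0, γ₀ * ‖y‖ ^ 2 ≤ S 0 y) (γ : ℕ → ℝ) (hγ0 : γ 0 = γ₀) (hγs : ∀ k, γ (k + 1) = a * γ k / (γ k + a * q ^ 2)) :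
    ∀ k, 0 < γ k ∧ ∀ y : E k, γ k * ‖y‖ ^ 2 ≤ S k y := by
  intro k
  induction k with
  | zero => exact ⟨by rw [hγ0]; exact hγ₀, fun y => by rw [hγ0]; exact h0 y⟩
  | succ k ih =>
    obtain ⟨hpos, hS⟩ := ih
    refine ⟨by rw [hγs]; exact floor_of_sum_pos ha hpos, fun x => hstep k x _ fun y => ?_⟩
    rw [hγs]
    exact floor_of_sum ha hpos hS (hP k) x y

/-- The tower's floors obey the reciprocal recursion with EQUALITY: `(γ_{k+1})⁻¹ = a⁻¹ + q²(γ_k)⁻¹`. [folklore] -/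
theorem tower_inv_rec {a q : ℝ} (ha : 0 < a) (γ : ℕ → ℝ) (hpos : ∀ k, 0 < γ k) (hγs : ∀ k, γ (k + 1) = a * γ k / (γ k + a * q ^ 2))
    (k : ℕ) : (γ (k + 1))⁻¹ = a⁻¹ + q ^ 2 * (γ k)⁻¹ := by
  rw [hγs, inv_floor_of_sum ha (hpos k)]

/-- **THE TOWER WITH THE RESCALED CONTRACTION `q = L⁻¹` DOMINATES PRINT's `a_k`**: under `tower_floor`'s letters with `‖P k y‖ ≤ L⁻¹‖y‖`
(`1 < L`), for every level `k ≥ 1` and every `y : E k`: `(L^{−2k}γ₀⁻¹ + (a_k)⁻¹)⁻¹·‖y‖² ≤ S k y`, `a_k = B1.aSeq a L k`. [folklore] -/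
theorem tower_floor_aSeq (S : ∀ k, E k → ℝ) (P : ∀ k, E k → E (k + 1)) {a L γ₀ : ℝ} (ha : 0 < a) (hL : 1 < L) (hγ₀ : 0 < γ₀)
    (hP : ∀ (k) (y : E k), ‖P k y‖ ≤ L⁻¹ * ‖y‖)
    (hstep : ∀ (k) (x : E (k + 1)) (c : ℝ), (∀ y : E k, c ≤ S k y + a * ‖x - P k y‖ ^ 2) → c ≤ S (k + 1) x)
    (h0 : ∀ y : E 0, γ₀ * ‖y‖ ^ 2 ≤ S 0 y) {k : ℕ} (hk : 1 ≤ k) (y : E k) :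
    (((L ^ 2)⁻¹) ^ k * γ₀⁻¹ + (aSeq a L k)⁻¹)⁻¹ * ‖y‖ ^ 2 ≤ S k y := by
  -- the floor sequence of the tower
  let γ : ℕ → ℝ := fun n => Nat.rec γ₀ (fun _ g => a * g / (g + a * L⁻¹ ^ 2)) n
  have hγ0 : γ 0 = γ₀ := rfl
  have hγs : ∀ n, γ (n + 1) = a * γ n / (γ n + a * L⁻¹ ^ 2) := fun n => rfl
  have hT := tower_floor E S P ha hγ₀ hP hstep h0 γ hγ0 hγs
  have hpos : ∀ n, 0 < γ n := fun n => (hT n).1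
  have hrec : ∀ n, (γ (n + 1))⁻¹ ≤ a⁻¹ + (L ^ 2)⁻¹ * (γ n)⁻¹ := fun n => by
    rw [tower_inv_rec ha γ hpos hγs n, inv_pow]
  have hfloor := floor_ge_of_rec_aSeq ha hL hpos hrec hk
  rw [hγ0] at hfloor
  exact (mul_le_mul_of_nonneg_right hfloor (sq_nonneg _)).trans ((hT k).2 y)

/-- **THE UNIFORM FLOOR OF THE TOWER**: under the same letters, `(γ₀⁻¹ + (a(1 − L⁻²))⁻¹)⁻¹·‖y‖² ≤ S k y` at EVERY level `k`. [folklore] -/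
theorem tower_floor_uniform (S : ∀ k, E k → ℝ) (P : ∀ k, E k → E (k + 1)) {a L γ₀ : ℝ} (ha : 0 < a) (hL : 1 < L) (hγ₀ : 0 < γ₀)
    (hP : ∀ (k) (y : E k), ‖P k y‖ ≤ L⁻¹ * ‖y‖)
    (hstep : ∀ (k) (x : E (k + 1)) (c : ℝ), (∀ y : E k, c ≤ S k y + a * ‖x - P k y‖ ^ 2) → c ≤ S (k + 1) x)
    (h0 : ∀ y : E 0, γ₀ * ‖y‖ ^ 2 ≤ S 0 y) (k : ℕ) (y : E k) :
    (γ₀⁻¹ + (a * (1 - (L ^ 2)⁻¹))⁻¹)⁻¹ * ‖y‖ ^ 2 ≤ S k y := by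
  let γ : ℕ → ℝ := fun n => Nat.rec γ₀ (fun _ g => a * g / (g + a * L⁻¹ ^ 2)) n
  have hγ0 : γ 0 = γ₀ := rfl
  have hγs : ∀ n, γ (n + 1) = a * γ n / (γ n + a * L⁻¹ ^ 2) := fun n => rfl
  have hT := tower_floor E S P ha hγ₀ hP hstep h0 γ hγ0 hγs
  have hpos : ∀ n, 0 < γ n := fun n => (hT n).1
  have hrec : ∀ n, (γ (n + 1))⁻¹ ≤ a⁻¹ + (L ^ 2)⁻¹ * (γ n)⁻¹ := fun n => by
    rw [tower_inv_rec ha γ hpos hγs n, inv_pow]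
  have hfloor := floor_ge_uniform_aSeq ha hL hpos hrec k
  rw [hγ0] at hfloor
  exact (mul_le_mul_of_nonneg_right hfloor (sq_nonneg _)).trans ((hT k).2 y)

end Tower

/-! ## §6 Kernel toys -/

section Toys

/-- The one-step floor of §2 is ATTAINED in the quadratic model on `ℝ` (`S y = γy²`, `P y = qy`) at `y⋆ = aqx∕(γ + aq²)` — `aγ∕(γ + aq²)` is
sharp. -/
example (a γ q x : ℝ) (ha : 0 < a) (hγ : 0 < γ) :
    γ * (a * q * x / (γ + a * q ^ 2)) ^ 2 + a * (x - q * (a * q * x / (γ + a * q ^ 2))) ^ 2 = a * γ / (γ + a * q ^ 2) * x ^ 2 := by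
  have hD : γ + a * q ^ 2 ≠ 0 := by positivity
  field_simp
  ring

/-- Non-vacuity of §2 on `ℝ × ℝ`: `S y = γ‖y‖²`, `P y = q•y` inhabit every hypothesis of `floor_of_sum`. -/
example (a γ q : ℝ) (ha : 0 < a) (hγ : 0 < γ) (hq : 0 ≤ q) (x y : ℝ) :
    a * γ / (γ + a * q ^ 2) * ‖x‖ ^ 2 ≤ γ * ‖y‖ ^ 2 + a * ‖x - q * y‖ ^ 2 :=
  floor_of_sum (S := fun y : ℝ => γ * ‖y‖ ^ 2) (P := fun y : ℝ => q * y) ha hγ (fun _ => le_rfl)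
    (fun y => by rw [norm_mul, Real.norm_of_nonneg hq]) x y

end Toys

end Summit.QuantumFields.BalabanUV.T4Continuum.NE7b.AveragingFloorTower
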